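/-
Copyright (c) 2026 the pub-hodgecm-mathlib formalisation cell (harness21).  Prover seat hodgecm-mathlib-A-p19 (g24) — (U) road, U4-DISCHARGE (cpt) junction, 2026-09-01.
-/
import Literature.NumberTheory.Weil1964.UnitaryArchLocalSkewCongrDiagonal        -- ★ FILE 3 (F0P3-p03 g11): `setLIntegral_cayleyWeightC_cayleySourceC_eq_of_definite_diagonal`, `…_eq_of_skewC_eq`
import Literature.NumberTheory.Weil1964.UnitaryArchLocalTraceFormNondegenerate   -- ★ U1′ p844433: `isHaarMeasure_archLocalTopFormHaar_diagonal` (+ ★ U1 `archLocalTopFormHaar`)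
import Literature.NumberTheory.Automorphic.ArchLocalRegularTorusClasses          -- ★ `UnitaryGroup.im_embedding_eq_zero_of_complexConj_eq`
import Mathlib.Analysis.Matrix.PosDef
import HarnessLib

/-!
# The compact top-form block masses are ONE number per size — U4 `ArchTopFormWallCompatible` (cpt) half, modulo the local «mass = source integral» identity
# ((U) road, U4-DISCHARGE junction; LEAD F0P3a-plan (g10) WORD T9-40 (d1)(d2); Rogawski 1990 §1.7, Macdonald 1980)

Topic `NumberTheory/Weil1964`; namespace `Literature.NumberTheory.Weil1964.UnitaryArchLocalTopForm`.  THEOREMS ONLY (no `def`, no instance, no notation, no axiom, no named fact,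
no `sorry`).  Cell `pub/hodgecm-mathlib`, crux H413 = `stmt-HodgeConjecture-24833` (supports only).  Count-neutral.  HONEST LABEL: HC_CM is proved only modulo the 2 remaining
named inputs (hLiu418, h413) until rung 0 closes; U4 (★ p844462, in-house) is NOT proved here.

WHAT THIS FILE DOES.  ★ p844714-to-be `archTopFormWallCompatible_of_blockMasses_of_clause` (owner junction) reduces U4 to three place-local inputs; the two COMPACT ones are
(W1a) `∀ w b (real, non-zero, re σ_w b₀ · re σ_w b₁ > 0), archLocalTopFormHaar L 2 (diagonal b) w univ = V₂` and (W1b) `∀ w x (real, non-zero), archLocalTopFormHaar L 1 (diagonal ![x]) w univ = V₁`.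
Here both are DISCHARGED MODULO ONE HYPOTHESIS SCHEMA `hii` = the local identity «total top-form mass = the window-free source integral `∫⁻_{source(σ_w diag b)} w₀ dλ`»
(U4-discharge piece (ii), A-p06 (g29)'s announced HEAD twin `archLocalTopFormHaar_univ_eq_lintegral` ∕ source form, taken at diagonal carriers with the Borel σ-algebra),
with the EXPLICIT constants `V_N := (∫⁻_{source(1_N)} w₀ dλ).toNNReal` (the reference carrier `diagonal (fun _ => 1)`):
* `map_embedding_diagonal_eq_diagonal_re` — a real diagonal carrier at a complex place IS a real diagonal matrix `diagonal (re σ_w b_i)`;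
* **`archLocalTopFormHaar_univ_eq_setLIntegral_one_of_definite`** — for a DEFINITE real diagonal carrier (all `re σ_w b_i` of one sign) the mass is the reference source integral
  (`hii`, then ★ FILE 3: same Lie algebra along the carrier identity, sign flip `𝔲(−J) = 𝔲(J)`, positive real diagonal congruence);
* `setLIntegral_one_ne_top_and_ne_zero` — the reference integral is finite and non-zero (it is the Haar mass of the COMPACT `U(1_N)(ℂ)` at any complex place of the CM field `L`:
  ★ `isCompact_archLocal_of_posDef`, ★ U1′);
* **`blockMass_two_of_massEqSource`**, **`blockMass_one_of_massEqSource`** — (W1a), (W1b) in the junction's exact binder shape, with `V₂ ≠ 0`, `V₁ ≠ 0`.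
So after this file U4 = {(ii) (A-p06 g29), (W2) = CENSUS-Jval (b2): the (J-nc) constant of the top-form wall-block measure is `−V₂·V₁`}.  The VALUES (`V₁ = π` ★ p844681 A-p12 (g20);
`V₂ = π³∕2` wanted) identify the constants but are not needed for (cpt).

## References
* [Rogawski1990] J. D. Rogawski, *Automorphic Representations of Unitary Groups in Three Variables*, Ann. of Math. Stud. 123 (1990), §1.7 p. 6; §8.2 p. 118.
* [Macdonald1980] I. G. Macdonald, *The volume of a compact Lie group*, Invent. Math. 56 (1980), p. 93.
* [Knapp2002] A. W. Knapp, *Lie Groups Beyond an Introduction*, 2nd ed. (2002), I §1.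
-/

set_option autoImplicit false

noncomputable section

open Set Filter Topology MeasureTheory MeasureTheory.Measure NumberField NumberField.InfinitePlace
open scoped Classical Matrix Matrix.Norms.Operator MatrixGroups ENNReal NNReal ComplexConjugate ComplexOrder

namespace Literature.NumberTheory.Weil1964

namespace UnitaryArchLocalTopForm

open Literature.NumberTheory.Automorphic Literature.NumberTheory.Automorphic.UnitaryGroup

variable (L : Type) [Field L] [NumberField L] [IsCMField L]

/-! ## §1 Real diagonal carriers at a complex place -/

section Carrier

variable {N : ℕ}

/-- A `c`-fixed diagonal carrier at a complex place is the REAL diagonal matrix `diagonal (re σ_w b_i)`. [cite: Rogawski1990, §4.9 p. 54] -/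
theorem map_embedding_diagonal_eq_diagonal_re (w : {w : InfinitePlace L // IsComplex w}) (b : Fin N → L) (hbr : ∀ i, (IsCMField.complexConj L (b i) : L) = b i) :
    (Matrix.diagonal b).map w.1.embedding = Matrix.diagonal fun i => (((w.1.embedding (b i)).re : ℝ) : ℂ) := by
  rw [Matrix.diagonal_map (map_zero _)]
  congr 1
  funext i
  exact Complex.ext (by simp) (by simp [UnitaryGroup.im_embedding_eq_zero_of_complexConj_eq L w (hbr i)])

omit [NumberField L] [IsCMField L] in
/-- The reference carrier `diagonal (fun _ => 1)` at any place is `1`, hence positive definite. [cite: Knapp2002, I §1] -/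
theorem posDef_map_embedding_diagonal_one (w : {w : InfinitePlace L // IsComplex w}) :
    ((Matrix.diagonal fun _ : Fin N => (1 : L)).map w.1.embedding).PosDef := by
  rw [Matrix.diagonal_map (map_zero _)]
  simp only [map_one, Matrix.diagonal_one]
  exact Matrix.PosDef.one

/-- For a non-zero `c`-fixed `x`, `re σ_w x ≠ 0`. [cite: Rogawski1990, §4.9 p. 54] -/
theorem re_embedding_ne_zero (w : {w : InfinitePlace L // IsComplex w}) {x : L} (hx : x ≠ 0) (hxr : (IsCMField.complexConj L x : L) = x) : (w.1.embedding x).re ≠ 0 := fun h =>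
  hx ((map_eq_zero w.1.embedding).1 (Complex.ext h (UnitaryGroup.im_embedding_eq_zero_of_complexConj_eq L w hxr)))

end Carrier

/-! ## §2 The mass of a definite real diagonal carrier is the reference source integral (modulo (ii)) -/

section Mass

variable {N : ℕ}

/-- **THE COMPACT TOP-FORM MASS IS CARRIER- AND PLACE-FREE (modulo (ii))**: if «mass = source integral» holds for the real diagonal carriers of size `N` (hypothesis `hii`, U4-discharge
piece (ii)), then for every DEFINITE real diagonal carrier `b` at every complex place `w`, `archLocalTopFormHaar L N (diagonal b) w univ = ∫⁻_{source(1_N)} w₀ dλ` (★ FILE 3: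
`𝔲(σ_w diag b) = 𝔲(diag(re σ_w b))`, sign flip, positive diagonal congruence to `1_N`). [cite: Rogawski1990, §1.7 p. 6] [cite: Macdonald1980, p. 93] -/
theorem archLocalTopFormHaar_univ_eq_setLIntegral_one_of_definite
    (hii : ∀ (w : {w : InfinitePlace L // IsComplex w}) (b : Fin N → L) (_hb : ∀ i, b i ≠ 0) (_hbr : ∀ i, (IsCMField.complexConj L (b i) : L) = b i)
      [MeasurableSpace (GL (Fin N) ℂ)] [BorelSpace (GL (Fin N) ℂ)]
      [MeasurableSpace (skewC N ((Matrix.diagonal b).map w.1.embedding))] [BorelSpace (skewC N ((Matrix.diagonal b).map w.1.embedding))],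
      archLocalTopFormHaar L N (Matrix.diagonal b) w Set.univ =
        ∫⁻ X in cayleySourceC N ((Matrix.diagonal b).map w.1.embedding), ENNReal.ofReal (cayleyWeightC N ((Matrix.diagonal b).map w.1.embedding) X)
          ∂(lieStdLebesgueC N ((Matrix.diagonal b).map w.1.embedding)))
    [MeasurableSpace (GL (Fin N) ℂ)] [BorelSpace (GL (Fin N) ℂ)]
    [MeasurableSpace (skewC N (Matrix.diagonal fun _ : Fin N => ((1 : ℝ) : ℂ)))] [BorelSpace (skewC N (Matrix.diagonal fun _ : Fin N => ((1 : ℝ) : ℂ)))]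
    (w : {w : InfinitePlace L // IsComplex w}) (b : Fin N → L) (hb : ∀ i, b i ≠ 0) (hbr : ∀ i, (IsCMField.complexConj L (b i) : L) = b i)
    (hdef : (∀ i, 0 < (w.1.embedding (b i)).re) ∨ (∀ i, (w.1.embedding (b i)).re < 0)) :
    archLocalTopFormHaar L N (Matrix.diagonal b) w Set.univ =
      ∫⁻ X in cayleySourceC N (Matrix.diagonal fun _ : Fin N => ((1 : ℝ) : ℂ)), ENNReal.ofReal (cayleyWeightC N (Matrix.diagonal fun _ : Fin N => ((1 : ℝ) : ℂ)) X)
        ∂(lieStdLebesgueC N (Matrix.diagonal fun _ : Fin N => ((1 : ℝ) : ℂ))) := by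
  letI i1 : MeasurableSpace (skewC N ((Matrix.diagonal b).map w.1.embedding)) := borel _
  haveI : BorelSpace (skewC N ((Matrix.diagonal b).map w.1.embedding)) := ⟨rfl⟩
  rw [hii w b hb hbr]
  set d : Fin N → ℝ := fun i => (w.1.embedding (b i)).re with hd
  have hJ : (Matrix.diagonal b).map w.1.embedding = Matrix.diagonal fun i => (d i : ℂ) := map_embedding_diagonal_eq_diagonal_re L w b hbr
  letI i2 : MeasurableSpace (skewC N (Matrix.diagonal fun i => (d i : ℂ))) := borel _
  haveI : BorelSpace (skewC N (Matrix.diagonal fun i => (d i : ℂ))) := ⟨rfl⟩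
  have hS : skewC N ((Matrix.diagonal b).map w.1.embedding) = skewC N (Matrix.diagonal fun i => (d i : ℂ)) := by rw [hJ]
  exact (setLIntegral_cayleyWeightC_cayleySourceC_eq_of_skewC_eq (Jw := Matrix.diagonal fun i => (d i : ℂ)) (Jw₂ := (Matrix.diagonal b).map w.1.embedding) hS).symm.trans
    (setLIntegral_cayleyWeightC_cayleySourceC_eq_of_definite_diagonal d (fun _ => (1 : ℝ)) hdef (Or.inl fun _ => one_pos))

/-- **The reference source integral `∫⁻_{source(1_N)} w₀ dλ` is FINITE and NON-ZERO** (modulo (ii)): it is the top-form Haar mass of the compact group `U(1_N)(ℂ)` at a complex place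
of the CM field `L` (★ `isCompact_archLocal_of_posDef`, ★ `isHaarMeasure_archLocalTopFormHaar_diagonal`). [cite: Macdonald1980, p. 93] [cite: Rogawski1990, §1.7 p. 6] -/
theorem setLIntegral_one_ne_top_and_ne_zero
    (hii : ∀ (w : {w : InfinitePlace L // IsComplex w}) (b : Fin N → L) (_hb : ∀ i, b i ≠ 0) (_hbr : ∀ i, (IsCMField.complexConj L (b i) : L) = b i)
      [MeasurableSpace (GL (Fin N) ℂ)] [BorelSpace (GL (Fin N) ℂ)]
      [MeasurableSpace (skewC N ((Matrix.diagonal b).map w.1.embedding))] [BorelSpace (skewC N ((Matrix.diagonal b).map w.1.embedding))],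
      archLocalTopFormHaar L N (Matrix.diagonal b) w Set.univ =
        ∫⁻ X in cayleySourceC N ((Matrix.diagonal b).map w.1.embedding), ENNReal.ofReal (cayleyWeightC N ((Matrix.diagonal b).map w.1.embedding) X)
          ∂(lieStdLebesgueC N ((Matrix.diagonal b).map w.1.embedding)))
    [MeasurableSpace (skewC N (Matrix.diagonal fun _ : Fin N => ((1 : ℝ) : ℂ)))] [BorelSpace (skewC N (Matrix.diagonal fun _ : Fin N => ((1 : ℝ) : ℂ)))] :
    (∫⁻ X in cayleySourceC N (Matrix.diagonal fun _ : Fin N => ((1 : ℝ) : ℂ)), ENNReal.ofReal (cayleyWeightC N (Matrix.diagonal fun _ : Fin N => ((1 : ℝ) : ℂ)) X)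
        ∂(lieStdLebesgueC N (Matrix.diagonal fun _ : Fin N => ((1 : ℝ) : ℂ)))) ≠ ⊤ ∧
      (∫⁻ X in cayleySourceC N (Matrix.diagonal fun _ : Fin N => ((1 : ℝ) : ℂ)), ENNReal.ofReal (cayleyWeightC N (Matrix.diagonal fun _ : Fin N => ((1 : ℝ) : ℂ)) X)
        ∂(lieStdLebesgueC N (Matrix.diagonal fun _ : Fin N => ((1 : ℝ) : ℂ)))) ≠ 0 := by
  letI : MeasurableSpace (GL (Fin N) ℂ) := borel _
  haveI : BorelSpace (GL (Fin N) ℂ) := ⟨rfl⟩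
  -- a complex place of the (totally complex) CM field `L`
  let w₀ : {w : InfinitePlace L // IsComplex w} := ⟨Classical.arbitrary (InfinitePlace L), IsTotallyComplex.isComplex _⟩
  have key := archLocalTopFormHaar_univ_eq_setLIntegral_one_of_definite L hii w₀ (fun _ => (1 : L)) (fun _ => one_ne_zero) (fun _ => map_one _)
    (Or.inl fun _ => by simp [map_one])
  rw [← key]
  haveI := isHaarMeasure_archLocalTopFormHaar_diagonal L N w₀ (fun _ => (1 : L)) (fun _ => one_ne_zero) (fun _ => map_one _)
  haveI : CompactSpace (archLocal L N (Matrix.diagonal fun _ : Fin N => (1 : L)) w₀) :=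
    isCompact_iff_compactSpace.mp (isCompact_archLocal_of_posDef L N (Matrix.diagonal fun _ : Fin N => (1 : L)) w₀ (Or.inl (posDef_map_embedding_diagonal_one L w₀)))
  exact ⟨measure_ne_top _ _, (isOpen_univ.measure_pos (archLocalTopFormHaar L N (Matrix.diagonal fun _ : Fin N => (1 : L)) w₀) univ_nonempty).ne'⟩

end Mass

/-! ## §3 (W1a) and (W1b) in the junction's binder shape -/

section Blocks

/-- **(W1a) THE RANK-2 COMPACT BLOCK MASS IS ONE `V₂ ≠ 0`** (modulo (ii) at `N = 2`): with `V₂ := (∫⁻_{source(1_2)} w₀ dλ).toNNReal`, for every complex place `w` and every real non-zero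
`b : Fin 2 → L` with `re σ_w b₀ · re σ_w b₁ > 0`, `archLocalTopFormHaar L 2 (diagonal b) w univ = V₂` — the hypothesis `hm₂` of the junction `archTopFormWallCompatible_of_blockMasses_of_clause`.
[cite: Rogawski1990, §1.7 p. 6; §8.2 p. 118] [cite: Macdonald1980, p. 93] -/
theorem blockMass_two_of_massEqSource
    (hii : ∀ (w : {w : InfinitePlace L // IsComplex w}) (b : Fin 2 → L) (_hb : ∀ i, b i ≠ 0) (_hbr : ∀ i, (IsCMField.complexConj L (b i) : L) = b i)
      [MeasurableSpace (GL (Fin 2) ℂ)] [BorelSpace (GL (Fin 2) ℂ)]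
      [MeasurableSpace (skewC 2 ((Matrix.diagonal b).map w.1.embedding))] [BorelSpace (skewC 2 ((Matrix.diagonal b).map w.1.embedding))],
      archLocalTopFormHaar L 2 (Matrix.diagonal b) w Set.univ =
        ∫⁻ X in cayleySourceC 2 ((Matrix.diagonal b).map w.1.embedding), ENNReal.ofReal (cayleyWeightC 2 ((Matrix.diagonal b).map w.1.embedding) X)
          ∂(lieStdLebesgueC 2 ((Matrix.diagonal b).map w.1.embedding)))
    [MeasurableSpace (skewC 2 (Matrix.diagonal fun _ : Fin 2 => ((1 : ℝ) : ℂ)))] [BorelSpace (skewC 2 (Matrix.diagonal fun _ : Fin 2 => ((1 : ℝ) : ℂ)))] :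
    (∫⁻ X in cayleySourceC 2 (Matrix.diagonal fun _ : Fin 2 => ((1 : ℝ) : ℂ)), ENNReal.ofReal (cayleyWeightC 2 (Matrix.diagonal fun _ : Fin 2 => ((1 : ℝ) : ℂ)) X)
        ∂(lieStdLebesgueC 2 (Matrix.diagonal fun _ : Fin 2 => ((1 : ℝ) : ℂ)))).toNNReal ≠ 0 ∧
      ∀ [MeasurableSpace (GL (Fin 2) ℂ)] [BorelSpace (GL (Fin 2) ℂ)] (w : {w : InfinitePlace L // IsComplex w}) (b : Fin 2 → L) (_hb : ∀ i, b i ≠ 0)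
        (_hbr : ∀ i, (IsCMField.complexConj L (b i) : L) = b i), 0 < (w.1.embedding (b 0)).re * (w.1.embedding (b 1)).re →
        archLocalTopFormHaar L 2 (Matrix.diagonal b) w Set.univ =
          ((∫⁻ X in cayleySourceC 2 (Matrix.diagonal fun _ : Fin 2 => ((1 : ℝ) : ℂ)), ENNReal.ofReal (cayleyWeightC 2 (Matrix.diagonal fun _ : Fin 2 => ((1 : ℝ) : ℂ)) X)
            ∂(lieStdLebesgueC 2 (Matrix.diagonal fun _ : Fin 2 => ((1 : ℝ) : ℂ)))).toNNReal : ℝ≥0∞) := by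
  obtain ⟨htop, hne⟩ := setLIntegral_one_ne_top_and_ne_zero L hii
  refine ⟨fun h0 => ?_, fun w b hb hbr hpos => ?_⟩
  · rcases ENNReal.toNNReal_eq_zero_iff _ |>.1 h0 with h | h
    · exact hne h
    · exact htop h
  · rw [ENNReal.coe_toNNReal htop]
    refine archLocalTopFormHaar_univ_eq_setLIntegral_one_of_definite L hii w b hb hbr ?_
    rcases mul_pos_iff.1 hpos with ⟨h0, h1⟩ | ⟨h0, h1⟩
    · exact Or.inl fun i => by fin_cases i <;> assumption
    · exact Or.inr fun i => by fin_cases i <;> assumption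

/-- **(W1b) THE RANK-1 BLOCK MASS IS ONE `V₁ ≠ 0`** (modulo (ii) at `N = 1`): with `V₁ := (∫⁻_{source(1_1)} w₀ dλ).toNNReal`, for every complex place `w` and every real non-zero `x : L`,
`archLocalTopFormHaar L 1 (diagonal ![x]) w univ = V₁` — the hypothesis `hm₁` of the junction (`V₁ = π`, ★ p844681, once (ii) lands). [cite: Rogawski1990, §1.7 p. 6; §8.2 p. 118] [cite: Macdonald1980, p. 93] -/
theorem blockMass_one_of_massEqSource
    (hii : ∀ (w : {w : InfinitePlace L // IsComplex w}) (b : Fin 1 → L) (_hb : ∀ i, b i ≠ 0) (_hbr : ∀ i, (IsCMField.complexConj L (b i) : L) = b i)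
      [MeasurableSpace (GL (Fin 1) ℂ)] [BorelSpace (GL (Fin 1) ℂ)]
      [MeasurableSpace (skewC 1 ((Matrix.diagonal b).map w.1.embedding))] [BorelSpace (skewC 1 ((Matrix.diagonal b).map w.1.embedding))],
      archLocalTopFormHaar L 1 (Matrix.diagonal b) w Set.univ =
        ∫⁻ X in cayleySourceC 1 ((Matrix.diagonal b).map w.1.embedding), ENNReal.ofReal (cayleyWeightC 1 ((Matrix.diagonal b).map w.1.embedding) X)
          ∂(lieStdLebesgueC 1 ((Matrix.diagonal b).map w.1.embedding)))
    [MeasurableSpace (skewC 1 (Matrix.diagonal fun _ : Fin 1 => ((1 : ℝ) : ℂ)))] [BorelSpace (skewC 1 (Matrix.diagonal fun _ : Fin 1 => ((1 : ℝ) : ℂ)))] :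
    (∫⁻ X in cayleySourceC 1 (Matrix.diagonal fun _ : Fin 1 => ((1 : ℝ) : ℂ)), ENNReal.ofReal (cayleyWeightC 1 (Matrix.diagonal fun _ : Fin 1 => ((1 : ℝ) : ℂ)) X)
        ∂(lieStdLebesgueC 1 (Matrix.diagonal fun _ : Fin 1 => ((1 : ℝ) : ℂ)))).toNNReal ≠ 0 ∧
      ∀ [MeasurableSpace (GL (Fin 1) ℂ)] [BorelSpace (GL (Fin 1) ℂ)] (w : {w : InfinitePlace L // IsComplex w}) (x : L) (_hx : x ≠ 0)
        (_hxr : (IsCMField.complexConj L x : L) = x),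
        archLocalTopFormHaar L 1 (Matrix.diagonal ![x]) w Set.univ =
          ((∫⁻ X in cayleySourceC 1 (Matrix.diagonal fun _ : Fin 1 => ((1 : ℝ) : ℂ)), ENNReal.ofReal (cayleyWeightC 1 (Matrix.diagonal fun _ : Fin 1 => ((1 : ℝ) : ℂ)) X)
            ∂(lieStdLebesgueC 1 (Matrix.diagonal fun _ : Fin 1 => ((1 : ℝ) : ℂ)))).toNNReal : ℝ≥0∞) := by
  obtain ⟨htop, hne⟩ := setLIntegral_one_ne_top_and_ne_zero L hii
  refine ⟨fun h0 => ?_, fun w x hx hxr => ?_⟩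
  · rcases ENNReal.toNNReal_eq_zero_iff _ |>.1 h0 with h | h
    · exact hne h
    · exact htop h
  · rw [ENNReal.coe_toNNReal htop]
    have hx' := re_embedding_ne_zero L w hx hxr
    refine archLocalTopFormHaar_univ_eq_setLIntegral_one_of_definite L hii w ![x] (fun i => by fin_cases i; exact hx) (fun i => by fin_cases i; exact hxr) ?_
    rcases lt_or_gt_of_ne hx' with hlt | hgt
    · exact Or.inr fun i => by fin_cases i; exact hlt
    · exact Or.inl fun i => by fin_cases i; exact hgt

end Blocks

end UnitaryArchLocalTopForm

end Literature.NumberTheory.Weil1964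

end
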